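import Summits.QuantumFields.BalabanUV.T4Continuum.Support.InsertionChannelFamily
import Summits.QuantumFields.BalabanUV.T4Continuum.Support.OutputRateFunctionalTablesComplexPointwise

/-!
# InsertionChannelFamilyComplex — the channel road carried to Road D, part 5: THE CHANNEL INSERTION ON THE COMPLEX TWO-ROW CHART OF
# RECORD (owner R49 (4)) — ROW-BLIND, COMPLEX ENTRIES; MI-3a with gain `√2·c`; the exact structural binders; the owner's Re∕Im END
# (`OutputRateFunctionalTablesComplexPointwise.ne5_of_pointwiseSlots_reIm`, p227588) with `hdamp` DISCHARGED from row NE9's displayed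
# channel letters on the DOUBLED chart
# (cell `pub-balaban`, T⁴ fan-out; row NE5, node U3; `HOME/t4/formal/NE5/LEAVES.md` row O1-c follower; journal F3 l.15813, owner RULING
# R49 l.16073, parts 1–4 = p228265 ∕ p228521 ∕ p229012 ∕ p229246, INTENT l.18625)

Unit `b2b-balaban-t4-ne5-formalise-leaf-06` (NE5 formalisation swarm, leaf prover 06, gen 13).  Summits-side NEW WORK under the LEAN
PLACEMENT RULE (cell modelling + bookkeeping over ABSTRACT carriers; nothing of the manuscripts under audit is asserted; 0 cite tags; no
`Prop`-valued fact minted — trigger `t4/T4-NE5-TRIGGER.json` c3; the one `def` is DATA).  HONEST FRAMING: rung (B)+1 of the FINITE-VOLUME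
T⁴ continuum programme — NOT infinite volume, NOT a mass gap, NOT the Clay problem, NOT a proof of NE5 (`T4OutputRate.NE5`, NOT PRINTED;
cell GAPS G-t4-U3-1) nor of NE9; spine 0/9 unchanged; 0/12 leaves instantiated on Bałaban's concrete objects (O1 = the substrate cell,
owner R34).  HONEST DEPENDENCY (cell line, verbatim): continuum YM on T⁴ ⇐ BetaPertH ∧ nine spine estimates (0/9 proved); BetaPertH ⇐
(D1) ∧ (D4) ∧ CAP+tail; G-an2-4 gates asym, D1 and NE2/3/4.

WHY (located design point of this lineage; nothing landed is false).  Parts 1–4 are chart-POLYMORPHIC, so they elaborate at the chart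
`𝒰 × Fin 2` of the owner's Re∕Im road (`OutputRateFunctionalTablesComplex` ∕ `…ComplexPointwise`: the complex values of Bałaban's terms on
the complex chart `𝒰` ride as TWO REAL ROWS, and the per-point slots `P : PointwiseSlots C (𝒰 × Fin 2) Op Hist` are read at BOTH rows of a
point by the SAME functional against the SAME complex value — «at the instance constant in the row index»).  But part 1's insertion
`insAtOfChannel T out g (k+1) t (u, i) = tableOf F (chanEntries … (u, i))` has REAL-cast entries and DEPENDS ON THE ROW `i`: at a complex
background the localized earlier terms ([Balaban1988RG2Cluster] Lemma 1 (1.33) p. 9, obtained through the Cauchy formulas (1.23) p. 7 on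
the complex domain) are COMPLEX numbers — ONE inserted history per complex point, with complex entries.  The repair is a definition:
read row NE9's channel `T` on the DOUBLED chart `Bg := 𝒰 × Fin 2` — its families `(𝒰 × Fin 2) → C.Dom → ℝ` ARE Road D's `toBgFamily` of
the two-row tables `C.Dom × (𝒰 × Fin 2) → ℝ`, i.e. the Re∕Im rows of complex background families — with TWO output indices per frame
entry (`out (u,0) i` ↦ the real part, `out (u,1) i` ↦ the imaginary part of the entry `i` at the complex point `u`; a real-linear channel
on two-row families expresses every ℂ-linear localization operator with COMPLEX kernel: `Re(T_ℂ f) = T₀f₀ − T₁f₁`, `Im(T_ℂ f) = T₁f₀ + T₀f₁`),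
and insert at EVERY row of the point `u` the ONE history `insAt … (u,0) + I • insAt … (u,1)`.  (The Re∕Im doubling device is row
NE9's own for its TARGET functional — `NE9ComplexEncoding` doubles the DOMAIN index; here the BACKGROUND index of the channel's input
families is doubled, which is what Road D's two-row chart already does to the tables.)

WHAT THIS FILE TYPES ([folklore] bookkeeping; 0 sorry; every NE9 shape enters BY NAME as a displayed hypothesis, none is discharged):
* §0 `norm_add_I_smul_le` — two histories with REAL read-outs and norms `≤ B` combine to `‖h₀ + I • h₁‖ ≤ √2·B`
  (`Complex.norm_le_sqrt_two_mul_max` entry by entry; the `√2` of `OutputRateFunctionalTablesComplex.complex_of_ne5_reImTab`).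
* §1 DATA **`insAtOfChannelC T out g k t w := insAtOfChannel T out g k t (w.1, 0) + I • insAtOfChannel T out g k t (w.1, 1)`** —
  ROW-BLIND (`insAtOfChannelC_rowBlind`, `rfl`); `bddAbove_insAtC`; `im_read_insAt` (part 1's insertion has real read-outs, both branches of `tableOf`);
  **`read_insAtC_succ`** — THE COMPLEX FUNCTION-TABLE READING DISPLAYED: when both entry vectors at `u` are level-bounded,
  `F.read (insAtOfChannelC … (k+1) t (u, j)) i = T k g (toBgFamily t) (out (u,0) i) + I·T k g (toBgFamily t) (out (u,1) i)`
  (+ `re_read_insAtC_succ` ∕ `im_read_insAtC_succ`: the entries ARE complex — Im = the row-`1` channel output).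
* §2 **`norm_insAtC_sub_le`** — the per-point MI-3a bound with gain **`√2·c`** (part 1's `norm_insAt_sub_le` at `(u,0)` and `(u,1)` on
  the doubled chart + §0; `√2` is the honest price of carrying one complex entry as two real rows EACH bounded by `D·e^{−κd}`);
  `insAtC_eq_of_agree` (blindness above the step, exact, `ChannelLocal univ T`); for leaf-02's per-point slots
  `P : PointwiseSlots C (𝒰 × Fin 2) Op (Hist F)` whose run-A insertion IS `insAtOfChannelC T out` on the window:
  `insertionDampedNat_pointwise_of_insAtC`, **`insertionDamped_pointwise_of_insAtC`** (= EXACTLY the `hdamp` hypothesis of the owner's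
  `ne5_of_pointwiseSlots_reIm`, gain `√2·c∕ω`), `insertionDampedNat_of_insAtC` (model level), `insBlind_of_insAtC` (exact).
* §3 END **`ne5_of_pointwiseSlots_reIm_insAtC`** = the owner's `ne5_of_pointwiseSlots_reIm` VERBATIM IN TYPE (names: its insertion-rate
  binder `hins` is `hinsRate` here, its section `ι` is `ι'` — `ι` being the output-index type of this namespace) with `hdamp` REPLACED by
  `hins : P.insA = insAtOfChannelC T out` on `W` + row NE9's displayed letters on the doubled chart (`ChannelAdditive univ T`,
  `ChannelStepSum univ T`, `ChannelSizeAtStepNN univ T κ wt τ`, the weight dictionary `0 ≤ wt k (out w i) ≤ P.rHist (k+1)·F.wt i`, the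
  profile `τ k j ≤ c·ω^{k−j}`, `0 ≤ c`, `0 < ω`) ⟹ `T4OutputRate.NE5 EA EB W κ θ (4G(δ+δ′)(θ−ω)∕(θ−(1+4G(√2c∕ω))ω))` over the ORIGINAL
  carriers along the real section `ι'` (no surjectivity).  Part 6 (`InsertionChannelFamilyComplexLinear`) carries the LINEAR-EXTENSION
  twin `insLinOfChannelC` (part 3's Hamel retraction on the doubled chart) with the EXACT structural binders and the E1′ face.
HONEST RIDER (displayed here, asserted by nobody).  On this road row NE9's channel binders are READ ON THE DOUBLED COMPLEX CHART — the
Re∕Im parts of [II] Lemma 1's localization operator at complex backgrounds with ONE common profile `τ` of the REAL two-output channel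
(under the per-row input majorants of `ChannelSizeAtStepNN` that profile may exceed the complex-modulus profile of the ℂ-linear operator by
a second factor `≤ √2`, absorbed in the free letter `c` — the INPUT-side twin of §2's output-side `√2`) — the channel-side analogue of
R49 (4)'s rider for rows NE2∕NE3 (Q-NE3-ℂ); whether row NE9's S5 supplies them there is row NE9's ∕ the substrate's reading.
NOT IN THIS FILE (said plainly).  No instance on Bałaban's objects (which `T`, `out`, frame `F` serve the record at the complex chart is
the substrate's O-8 ∕ D-8 reading, owner R34); no NE9 binder discharged; no W1 ∕ W2 ∕ representation hypothesis touched; no `√2`-free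
variant claimed (only a MODULUS majorant of the two-row table differences in the recursion — complex currency, not the real kernel of
record — would give it; a weighted-ℓ² entry norm would not: the `√2` comes from two independent per-ROW majorants, sharp at `|a| = |b|`); the owner's real-slice W1 END (g36-a)
composed on top is left to the owner ∕ a later part.  Headline wording (owner R30 (ii) ∕ R35): «NE5 channel
road carried to Road D's complex chart — junction only»; never «leaf instantiated».  NE5 NOT PROVED; NE9 NOT PROVED; spine 0/9; rung
(B)+1 finite T⁴; NOT infinite volume ∕ mass gap ∕ Clay.  Axioms ⊆ {propext, Classical.choice, Quot.sound}.
-/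

noncomputable section

open scoped BigOperators
open Finset Function Metric Set Complex

namespace Summit.QuantumFields.BalabanUV.T4Continuum.InsertionChannelFamily

open Literature.MathematicalPhysics.QuantumFieldTheory.Balaban1983to89
open Literature.MathematicalPhysics.QuantumFieldTheory.Balaban1983to89.T4OutputRate (Carriers Functional NE5)
open Literature.MathematicalPhysics.QuantumFieldTheory.Balaban1983to89.T4InputCauchyRateData (StepModel tableA tableB mul_sum_age_shift)
open Literature.MathematicalPhysics.QuantumFieldTheory.Balaban1983to89.T4HistoryLipschitzRecursion
  (ChannelAdditive ChannelLocal ChannelStepSum ChannelSizeAtStepNN)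
open Summit.QuantumFields.BalabanUV.T4Continuum.B13HistDatum (HistFrame Hist)
open Summit.QuantumFields.BalabanUV.T4Continuum.InsertionChannelReading (read_sub)
open Summit.QuantumFields.BalabanUV.T4Continuum.InsertionChannelInstance (tableOf read_tableOf)
open Summit.QuantumFields.BalabanUV.T4Continuum.OutputRateFunctionalTables
open Summit.QuantumFields.BalabanUV.T4Continuum.OutputRateFunctionalTablesFamily (Fam famOf famOf_apply toBgFamily norm_famOf_sub_famOf_le)
open Summit.QuantumFields.BalabanUV.T4Continuum.OutputRateFunctionalTablesPointwise (PointwiseSlots)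
open Summit.QuantumFields.BalabanUV.T4Continuum.OutputRateFunctionalTablesComplex (reImTab)
open Summit.QuantumFields.BalabanUV.T4Continuum.OutputRateFunctionalTablesComplexPointwise (ne5_of_pointwiseSlots_reIm)

variable {C : Carriers} {𝒰 ι : Type} {F : HistFrame C}

/-! ## §0 Two histories with real read-outs combined as `h₀ + I • h₁` -/

section NormLemma

/-- [folklore] The read-out of `h₀ + I • h₁`. -/
theorem read_add_I_smul (h₀ h₁ : Hist F) (i : F.Idx) : F.read (h₀ + I • h₁) i = F.read h₀ i + I * F.read h₁ i := by
  rw [← F.readCLM_apply, map_add, map_smul, F.readCLM_apply, F.readCLM_apply, smul_eq_mul]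

/-- [folklore] **`‖h₀ + I • h₁‖ ≤ √2·B` FOR HISTORIES WITH REAL READ-OUTS AND NORMS `≤ B`** — entry by entry the combined read-out is the
complex number with real part `Re (read h₀ i)` and imaginary part `Re (read h₁ i)`, of modulus `≤ √2·max` (`Complex.norm_le_sqrt_two_mul_max`). -/
theorem norm_add_I_smul_le {h₀ h₁ : Hist F} {B : ℝ} (hB : 0 ≤ B) (hn₀ : ‖h₀‖ ≤ B) (hn₁ : ‖h₁‖ ≤ B)
    (hr₀ : ∀ i, (F.read h₀ i).im = 0) (hr₁ : ∀ i, (F.read h₁ i).im = 0) : ‖h₀ + I • h₁‖ ≤ Real.sqrt 2 * B := by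
  have hB' : 0 ≤ Real.sqrt 2 * B := mul_nonneg (Real.sqrt_nonneg _) hB
  refine (F.norm_le_iff_read _ hB').2 fun i => ?_
  have h0i : ‖F.read h₀ i‖ ≤ B * F.wt i := (F.norm_le_iff_read _ hB).1 hn₀ i
  have h1i : ‖F.read h₁ i‖ ≤ B * F.wt i := (F.norm_le_iff_read _ hB).1 hn₁ i
  have hre : (F.read h₀ i + I * F.read h₁ i).re = (F.read h₀ i).re := by simp [hr₁ i]
  have him : (F.read h₀ i + I * F.read h₁ i).im = (F.read h₁ i).re := by simp [hr₀ i]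
  have ha : |(F.read h₀ i).re| ≤ B * F.wt i := (abs_re_le_norm _).trans h0i
  have hb : |(F.read h₁ i).re| ≤ B * F.wt i := (abs_re_le_norm _).trans h1i
  rw [read_add_I_smul]
  calc ‖F.read h₀ i + I * F.read h₁ i‖
      ≤ Real.sqrt 2 * max |(F.read h₀ i + I * F.read h₁ i).re| |(F.read h₀ i + I * F.read h₁ i).im| :=
        norm_le_sqrt_two_mul_max _
    _ = Real.sqrt 2 * max |(F.read h₀ i).re| |(F.read h₁ i).re| := by rw [hre, him]
    _ ≤ Real.sqrt 2 * (B * F.wt i) := mul_le_mul_of_nonneg_left (max_le ha hb) (Real.sqrt_nonneg _)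
    _ = Real.sqrt 2 * B * F.wt i := by ring

/-- [folklore] Differences: `(a₀ + I • a₁) − (b₀ + I • b₁) = (a₀ − b₀) + I • (a₁ − b₁)`. -/
theorem add_I_smul_sub_add_I_smul (a₀ a₁ b₀ b₁ : Hist F) :
    (a₀ + I • a₁) - (b₀ + I • b₁) = (a₀ - b₀) + I • (a₁ - b₁) := by
  rw [smul_sub]; abel

end NormLemma

/-! ## §1 The row-blind complex channel insertion on the two-row chart, and the reading displayed -/

section Data

variable (T : ℕ → (ℕ → ℝ) → (𝒰 × Fin 2 → C.Dom → ℝ) → ι → ℝ) (out : 𝒰 × Fin 2 → F.Idx → ι)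

/-- [folklore] DATA: **THE ROW-BLIND COMPLEX CHANNEL INSERTION ON THE TWO-ROW CHART** — at every row of the complex point `u` the ONE
history whose entries are the step-`k−1` channel outputs on the two-row background family of the table, real part read at the output
index `out (u,0) i`, imaginary part at `out (u,1) i` (part 1's by-construction insertion on the DOUBLED chart at the two rows,
combined as `h₀ + I • h₁`).  The shape of `PointwiseSlots.insA g` at the chart `𝒰 × Fin 2`. -/
def insAtOfChannelC (g : ℕ → ℝ) (k : ℕ) (t : C.Dom × (𝒰 × Fin 2) → ℝ) (w : 𝒰 × Fin 2) : Hist F :=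
  insAtOfChannel T out g k t (w.1, 0) + I • insAtOfChannel T out g k t (w.1, 1)

/-- [folklore] Step `0` inserts nothing. -/
@[simp] theorem insAtOfChannelC_zero (g : ℕ → ℝ) (t : C.Dom × (𝒰 × Fin 2) → ℝ) (w : 𝒰 × Fin 2) :
    insAtOfChannelC T out g 0 t w = 0 := by
  simp [insAtOfChannelC]

/-- [folklore] **ROW-BLIND**: the same history is inserted at both rows of a complex chart point («constant in the row index»). -/
theorem insAtOfChannelC_rowBlind (g : ℕ → ℝ) (k : ℕ) (t : C.Dom × (𝒰 × Fin 2) → ℝ) (u : 𝒰) (i j : Fin 2) :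
    insAtOfChannelC T out g k t (u, i) = insAtOfChannelC T out g k t (u, j) := rfl

/-- [folklore] **BOUNDED OVER THE CHART WHEN PART 1's INSERTION IS** (so the `hbdA` side condition of the owner's END for the complex
insertion follows from the one for part 1's insertion on the doubled chart). -/
theorem bddAbove_insAtC (g : ℕ → ℝ) (k : ℕ) (t : C.Dom × (𝒰 × Fin 2) → ℝ)
    (h : BddAbove (Set.range fun w => ‖insAtOfChannel T out g k t w‖)) :
    BddAbove (Set.range fun w => ‖insAtOfChannelC T out g k t w‖) := by
  obtain ⟨M, hM⟩ := h
  refine ⟨M + M, ?_⟩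
  rintro _ ⟨w, rfl⟩
  have h0 : ‖insAtOfChannel T out g k t (w.1, 0)‖ ≤ M := hM ⟨(w.1, 0), rfl⟩
  have h1 : ‖insAtOfChannel T out g k t (w.1, 1)‖ ≤ M := hM ⟨(w.1, 1), rfl⟩
  calc ‖insAtOfChannelC T out g k t w‖
      ≤ ‖insAtOfChannel T out g k t (w.1, 0)‖ + ‖I • insAtOfChannel T out g k t (w.1, 1)‖ := norm_add_le _ _
    _ ≤ M + M := add_le_add h0 (by rwa [norm_smul, norm_I, one_mul])

/-- [folklore] The zero history has zero read-outs. -/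
theorem read_zero (i : F.Idx) : F.read (0 : Hist F) i = 0 := by
  rw [← F.readCLM_apply, map_zero]

variable {𝒱 : Type} (T₁ : ℕ → (ℕ → ℝ) → (𝒱 → C.Dom → ℝ) → ι → ℝ) (out₁ : 𝒱 → F.Idx → ι) in
/-- [folklore] **PART 1's INSERTION HAS REAL READ-OUTS** (any chart): at step `0` the zero history; at step `k + 1` either the real-cast
channel entries (`read_tableOf`) or the junk `0`. -/
theorem im_read_insAt (g : ℕ → ℝ) (k : ℕ) (t : C.Dom × 𝒱 → ℝ) (v : 𝒱) (i : F.Idx) :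
    (F.read (insAtOfChannel T₁ out₁ g k t v) i).im = 0 := by
  classical
  cases k with
  | zero => rw [insAtOfChannel_zero, read_zero, zero_im]
  | succ k =>
    rw [insAtOfChannel_succ]
    by_cases h : ∃ μ : ℝ, ∀ j, ‖chanEntries T₁ out₁ k g t v j‖ ≤ μ * F.wt j
    · rw [read_tableOf h, chanEntries, ofReal_im]
    · rw [tableOf, dif_neg h, read_zero, zero_im]

/-- [folklore] **THE COMPLEX FUNCTION-TABLE READING, DISPLAYED**: when the step-`k` channel entries of the table are level-bounded at
both rows of `u`, the entry `i` of the history inserted at step `k + 1` (at either row) IS the complex number whose real part is the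
channel output at `out (u,0) i` and whose imaginary part is the channel output at `out (u,1) i`, both on the table's two-row
BACKGROUND FAMILY — [II] (1.33) read at a complex background with the earlier terms as complex functions of it. -/
theorem read_insAtC_succ {g : ℕ → ℝ} {k : ℕ} {t : C.Dom × (𝒰 × Fin 2) → ℝ} {u : 𝒰}
    (h₀ : ∃ μ : ℝ, ∀ i, ‖chanEntries T out k g t (u, 0) i‖ ≤ μ * F.wt i)
    (h₁ : ∃ μ : ℝ, ∀ i, ‖chanEntries T out k g t (u, 1) i‖ ≤ μ * F.wt i) (j : Fin 2) (i : F.Idx) :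
    F.read (insAtOfChannelC T out g (k + 1) t (u, j)) i =
      ((T k g (toBgFamily t) (out (u, 0) i) : ℝ) : ℂ) + I * ((T k g (toBgFamily t) (out (u, 1) i) : ℝ) : ℂ) := by
  rw [insAtOfChannelC, read_add_I_smul, read_insAt_succ T out h₀, read_insAt_succ T out h₁]

/-- [folklore] … its REAL PART is the channel output at the row-`0` index … -/
theorem re_read_insAtC_succ {g : ℕ → ℝ} {k : ℕ} {t : C.Dom × (𝒰 × Fin 2) → ℝ} {u : 𝒰}
    (h₀ : ∃ μ : ℝ, ∀ i, ‖chanEntries T out k g t (u, 0) i‖ ≤ μ * F.wt i)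
    (h₁ : ∃ μ : ℝ, ∀ i, ‖chanEntries T out k g t (u, 1) i‖ ≤ μ * F.wt i) (j : Fin 2) (i : F.Idx) :
    (F.read (insAtOfChannelC T out g (k + 1) t (u, j)) i).re = T k g (toBgFamily t) (out (u, 0) i) := by
  rw [read_insAtC_succ T out h₀ h₁]; simp

/-- [folklore] … and its IMAGINARY PART is the channel output at the row-`1` index — the entries ARE complex (the located design point:
part 1's real-cast insertion at the chart `𝒰 × Fin 2` has `im = 0`, `im_read_insAt`). -/
theorem im_read_insAtC_succ {g : ℕ → ℝ} {k : ℕ} {t : C.Dom × (𝒰 × Fin 2) → ℝ} {u : 𝒰}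
    (h₀ : ∃ μ : ℝ, ∀ i, ‖chanEntries T out k g t (u, 0) i‖ ≤ μ * F.wt i)
    (h₁ : ∃ μ : ℝ, ∀ i, ‖chanEntries T out k g t (u, 1) i‖ ≤ μ * F.wt i) (j : Fin 2) (i : F.Idx) :
    (F.read (insAtOfChannelC T out g (k + 1) t (u, j)) i).im = T k g (toBgFamily t) (out (u, 1) i) := by
  rw [read_insAtC_succ T out h₀ h₁]; simp

end Data

/-! ## §2 MI-3a with gain `√2·c`, blindness, and leaf-02's per-point slots reading the complex insertion -/

section InsAtC

variable {T : ℕ → (ℕ → ℝ) → (𝒰 × Fin 2 → C.Dom → ℝ) → ι → ℝ} {out : 𝒰 × Fin 2 → F.Idx → ι}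

/-- [folklore] **THE PER-POINT DAMPED-LIPSCHITZ BOUND OF THE COMPLEX CHANNEL INSERTION** (Nat age normalisation, gain `√2·c`): part 1's
`norm_insAt_sub_le` on the DOUBLED chart at the two rows of the point (both from the SAME displayed letters: row NE9's three binders on
all two-row families, the profile, the weight dictionary), combined by §0 (the differences have real read-outs). -/
theorem norm_insAtC_sub_le {κ c ω : ℝ} {wt : ℕ → ι → ℝ} {τ : ℕ → ℕ → ℝ} {rH : ℕ → ℝ}
    (hadd : ChannelAdditive (Set.univ : Set (𝒰 × Fin 2 → C.Dom → ℝ)) T)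
    (hsum : ChannelStepSum (Set.univ : Set (𝒰 × Fin 2 → C.Dom → ℝ)) T)
    (hsize : ChannelSizeAtStepNN (Set.univ : Set (𝒰 × Fin 2 → C.Dom → ℝ)) T κ wt τ) (hwt0 : ∀ k w i, 0 ≤ wt k (out w i))
    (hwt : ∀ k w i, wt k (out w i) ≤ rH (k + 1) * F.wt i) (hτ : ∀ k j, j ≤ k → τ k j ≤ c * ω ^ (k - j)) (hc : 0 ≤ c)
    (hω : 0 ≤ ω) (hrH : ∀ k, 0 ≤ rH k) (k : ℕ) (g : ℕ → ℝ) {t t' : C.Dom × (𝒰 × Fin 2) → ℝ} {D : ℕ → ℝ}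
    (hD : ∀ j < k, 0 ≤ D j)
    (hb : ∀ Y, C.scale Y < k → ∀ w, |t (Y, w) - t' (Y, w)| ≤ D (C.scale Y) * Real.exp (-(κ * C.d Y))) (w : 𝒰 × Fin 2) :
    ‖insAtOfChannelC T out g k t w - insAtOfChannelC T out g k t' w‖ ≤
      rH k * (Real.sqrt 2 * c * ∑ j ∈ range k, ω ^ (k - 1 - j) * D j) := by
  have hS : 0 ≤ ∑ j ∈ range k, ω ^ (k - 1 - j) * D j :=
    sum_nonneg fun j hj => mul_nonneg (pow_nonneg hω _) (hD j (mem_range.1 hj))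
  have hB : 0 ≤ rH k * (c * ∑ j ∈ range k, ω ^ (k - 1 - j) * D j) := mul_nonneg (hrH k) (mul_nonneg hc hS)
  rw [insAtOfChannelC, insAtOfChannelC, add_I_smul_sub_add_I_smul]
  refine (norm_add_I_smul_le hB (norm_insAt_sub_le hadd hsum hsize hwt0 hwt hτ hc hω hrH k g hD hb (w.1, 0))
    (norm_insAt_sub_le hadd hsum hsize hwt0 hwt hτ hc hω hrH k g hD hb (w.1, 1)) (fun i => ?_) (fun i => ?_)).trans_eq (by ring)
  · rw [read_sub, sub_im, im_read_insAt, im_read_insAt, sub_zero]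
  · rw [read_sub, sub_im, im_read_insAt, im_read_insAt, sub_zero]

/-- [folklore] **BLINDNESS ABOVE THE STEP, EXACT** (`ChannelLocal univ T` on the doubled chart): part 1's `insAt_eq_of_agree` at both rows. -/
theorem insAtC_eq_of_agree (hloc : ChannelLocal (Set.univ : Set (𝒰 × Fin 2 → C.Dom → ℝ)) T) (k : ℕ) (g : ℕ → ℝ)
    {t t' : C.Dom × (𝒰 × Fin 2) → ℝ} (h : ∀ Y, C.scale Y < k → ∀ w, t (Y, w) = t' (Y, w)) (w : 𝒰 × Fin 2) :
    insAtOfChannelC T out g k t w = insAtOfChannelC T out g k t' w := by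
  rw [insAtOfChannelC, insAtOfChannelC, insAt_eq_of_agree hloc k g h (w.1, 0), insAt_eq_of_agree hloc k g h (w.1, 1)]

variable {Op : Type*} [NormedAddCommGroup Op] [NormedSpace ℂ Op] (P : PointwiseSlots C (𝒰 × Fin 2) Op (Hist F))
  {W : Set (ℕ → ℝ)}

/-- [folklore] **THE PER-POINT MI-3a BINDER OF LEAF-02's SLOTS ON THE TWO-ROW CHART READING THE COMPLEX CHANNEL INSERTION, Nat form**
(gain `√2·c`, the slots' history margins; weight dictionary `0 ≤ wt k (out w i) ≤ P.rHist (k+1)·F.wt i`). -/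
theorem insertionDampedNat_pointwise_of_insAtC {κ c ω : ℝ} {wt : ℕ → ι → ℝ} {τ : ℕ → ℕ → ℝ}
    (hins : ∀ k, ∀ g ∈ W, ∀ (t : C.Dom × (𝒰 × Fin 2) → ℝ) (w : 𝒰 × Fin 2), P.insA g k t w = insAtOfChannelC T out g k t w)
    (hadd : ChannelAdditive (Set.univ : Set (𝒰 × Fin 2 → C.Dom → ℝ)) T)
    (hsum : ChannelStepSum (Set.univ : Set (𝒰 × Fin 2 → C.Dom → ℝ)) T)
    (hsize : ChannelSizeAtStepNN (Set.univ : Set (𝒰 × Fin 2 → C.Dom → ℝ)) T κ wt τ) (hwt0 : ∀ k w i, 0 ≤ wt k (out w i))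
    (hwt : ∀ k w i, wt k (out w i) ≤ P.rHist (k + 1) * F.wt i) (hτ : ∀ k j, j ≤ k → τ k j ≤ c * ω ^ (k - j)) (hc : 0 ≤ c)
    (hω : 0 ≤ ω) :
    ∀ k, ∀ g ∈ W, ∀ (t t' : C.Dom × (𝒰 × Fin 2) → ℝ) (D : ℕ → ℝ), (∀ j < k, 0 ≤ D j) →
      (∀ Y, C.scale Y < k → ∀ w, |t (Y, w) - t' (Y, w)| ≤ D (C.scale Y) * Real.exp (-(κ * C.d Y))) →
        ∀ w, ‖P.insA g k t w - P.insA g k t' w‖ ≤ P.rHist k * (Real.sqrt 2 * c * ∑ j ∈ range k, ω ^ (k - 1 - j) * D j) := by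
  intro k g hg t t' D hD hb w
  rw [hins k g hg t w, hins k g hg t' w]
  exact norm_insAtC_sub_le hadd hsum hsize hwt0 hwt hτ hc hω (fun k => (P.rHist_pos k).le) k g hD hb w

/-- [folklore] **THE SAME IN THE KERNEL's C0 NORMALISATION — EXACTLY THE `hdamp` HYPOTHESIS OF THE OWNER's Re∕Im END**
`OutputRateFunctionalTablesComplexPointwise.ne5_of_pointwiseSlots_reIm` (and of leaf-02's `ne5_of_pointwiseSlots` at the chart
`𝒰 × Fin 2`): gain `√2·c∕ω`, weights `ω^{k−j}` (`mul_sum_age_shift`, `0 < ω`). -/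
theorem insertionDamped_pointwise_of_insAtC {κ c ω : ℝ} {wt : ℕ → ι → ℝ} {τ : ℕ → ℕ → ℝ}
    (hins : ∀ k, ∀ g ∈ W, ∀ (t : C.Dom × (𝒰 × Fin 2) → ℝ) (w : 𝒰 × Fin 2), P.insA g k t w = insAtOfChannelC T out g k t w)
    (hadd : ChannelAdditive (Set.univ : Set (𝒰 × Fin 2 → C.Dom → ℝ)) T)
    (hsum : ChannelStepSum (Set.univ : Set (𝒰 × Fin 2 → C.Dom → ℝ)) T)
    (hsize : ChannelSizeAtStepNN (Set.univ : Set (𝒰 × Fin 2 → C.Dom → ℝ)) T κ wt τ) (hwt0 : ∀ k w i, 0 ≤ wt k (out w i))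
    (hwt : ∀ k w i, wt k (out w i) ≤ P.rHist (k + 1) * F.wt i) (hτ : ∀ k j, j ≤ k → τ k j ≤ c * ω ^ (k - j)) (hc : 0 ≤ c)
    (hω : 0 < ω) :
    ∀ k, ∀ g ∈ W, ∀ (t t' : C.Dom × (𝒰 × Fin 2) → ℝ) (D : ℕ → ℝ), (∀ j < k, 0 ≤ D j) →
      (∀ Y, C.scale Y < k → ∀ w, |t (Y, w) - t' (Y, w)| ≤ D (C.scale Y) * Real.exp (-(κ * C.d Y))) →
        ∀ w, ‖P.insA g k t w - P.insA g k t' w‖ ≤ P.rHist k * (Real.sqrt 2 * c / ω * ∑ j ∈ range k, ω ^ (k - j) * D j) := by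
  intro k g hg t t' D hD hb w
  rw [← mul_sum_age_shift hω.ne' (Real.sqrt 2 * c) D]
  exact insertionDampedNat_pointwise_of_insAtC P hins hadd hsum hsize hwt0 hwt hτ hc hω.le k g hg t t' D hD hb w

/-- [folklore] **MODEL LEVEL: `InsertionDampedNat` (gain `√2·c`) OF THE FAMILY MODEL over `paramCarriers C (𝒰 × Fin 2)`** (nonempty
chart; the per-point bound lifted through `famOf` by leaf-02's `norm_famOf_sub_famOf_le`). -/
theorem insertionDampedNat_of_insAtC [Nonempty 𝒰] {κ c ω : ℝ} {wt : ℕ → ι → ℝ} {τ : ℕ → ℕ → ℝ}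
    (hins : ∀ k, ∀ g ∈ W, ∀ (t : C.Dom × (𝒰 × Fin 2) → ℝ) (w : 𝒰 × Fin 2), P.insA g k t w = insAtOfChannelC T out g k t w)
    (hadd : ChannelAdditive (Set.univ : Set (𝒰 × Fin 2 → C.Dom → ℝ)) T)
    (hsum : ChannelStepSum (Set.univ : Set (𝒰 × Fin 2 → C.Dom → ℝ)) T)
    (hsize : ChannelSizeAtStepNN (Set.univ : Set (𝒰 × Fin 2 → C.Dom → ℝ)) T κ wt τ) (hwt0 : ∀ k w i, 0 ≤ wt k (out w i))
    (hwt : ∀ k w i, wt k (out w i) ≤ P.rHist (k + 1) * F.wt i) (hτ : ∀ k j, j ≤ k → τ k j ≤ c * ω ^ (k - j)) (hc : 0 ≤ c)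
    (hω : 0 ≤ ω) : P.toStepModel.InsertionDampedNat W κ (Real.sqrt 2 * c) ω := by
  intro k g hg _ t t' D hD hb
  exact norm_famOf_sub_famOf_le
    (insertionDampedNat_pointwise_of_insAtC P hins hadd hsum hsize hwt0 hwt hτ hc hω k g hg t t' D hD (fun Y hY w => hb (Y, w) hY))

/-- [folklore] **MODEL LEVEL: `InsBlind` OF THE FAMILY MODEL, EXACT** (`ChannelLocal univ T` on the doubled chart). -/
theorem insBlind_of_insAtC
    (hins : ∀ k, ∀ g ∈ W, ∀ (t : C.Dom × (𝒰 × Fin 2) → ℝ) (w : 𝒰 × Fin 2), P.insA g k t w = insAtOfChannelC T out g k t w)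
    (hloc : ChannelLocal (Set.univ : Set (𝒰 × Fin 2 → C.Dom → ℝ)) T) : P.toStepModel.InsBlind W := by
  intro k g hg _ t t' h
  show famOf (P.insA g k t) = famOf (P.insA g k t')
  have : P.insA g k t = P.insA g k t' := funext fun w => by
    rw [hins k g hg t w, hins k g hg t' w]
    exact insAtC_eq_of_agree hloc k g (fun Y hY w => h (Y, w) hY) w
  rw [this]

end InsAtC

/-! ## §3 END: the owner's Re∕Im END with `hdamp` discharged from row NE9's channel letters on the doubled chart -/

section End

variable {T : ℕ → (ℕ → ℝ) → (𝒰 × Fin 2 → C.Dom → ℝ) → ι → ℝ} {out : 𝒰 × Fin 2 → F.Idx → ι}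
variable {Op : Type*} [NormedAddCommGroup Op] [NormedSpace ℂ Op] (P : PointwiseSlots C (𝒰 × Fin 2) Op (Hist F))

/-- [folklore] **END — THE OWNER's Re∕Im END ON ROAD D's COMPLEX CHART FOR SLOTS READING THE COMPLEX CHANNEL INSERTION**:
`OutputRateFunctionalTablesComplexPointwise.ne5_of_pointwiseSlots_reIm` with every hypothesis VERBATIM IN TYPE except `hdamp`, which is
DISCHARGED BY CONSTRUCTION (§2, gain `√2·c∕ω`) from `hins : P.insA = insAtOfChannelC T out` on the window and row NE9's DISPLAYED
letters on the doubled chart (`hadd`, `hsum`, `hsize`, the weight dictionary, the profile).  Conclusion LITERALLY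
`T4OutputRate.NE5 EA EB W κ θ C₅` over the ORIGINAL carriers, with the owner's constant at the gain `√2·c∕ω`. -/
theorem ne5_of_pointwiseSlots_reIm_insAtC [Nonempty 𝒰] {ℰA ℰB : (ℕ → ℝ) → 𝒰 → C.Dom → ℂ} {EA : Functional C C.BgA}
    {EB : Functional C C.BgB} {W : Set (ℕ → ℝ)} {κ G E₀ δ δ' θ c ω : ℝ} {wt : ℕ → ι → ℝ} {τ : ℕ → ℕ → ℝ}
    (hbdA : ∀ g ∈ W, ∀ k, BddAbove (Set.range fun w => ‖P.insA g k (tableA (reImTab (C := C) ℰA) g PUnit.unit) w‖))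
    (hbdB : ∀ g ∈ W, ∀ k, BddAbove (Set.range fun w => ‖P.insB g k (tableB (reImTab (C := C) ℰB) g PUnit.unit) w‖))
    (hrA : ∀ g ∈ W, ∀ (X : C.Dom) (u : 𝒰) (i : Fin 2), ℰA g u X =
      P.Out (C.scale X) (P.opA g (C.scale X) (u, i))
        (P.insA g (C.scale X) (tableA (reImTab (C := C) ℰA) g PUnit.unit) (u, i)) X)
    (hrB : ∀ g ∈ W, ∀ (X : C.Dom) (u : 𝒰) (i : Fin 2), ℰB g u X =
      P.Out (C.scale X) (P.opB g (C.scale X) (u, i))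
        (P.insB g (C.scale X) (tableB (reImTab (C := C) ℰB) g PUnit.unit) (u, i)) X)
    (hbase : ∀ k, ∀ g ∈ W, ∀ w,
      (P.opB g k w, P.insB g k (tableB (reImTab (C := C) ℰB) g PUnit.unit) w) ∈ P.Base k g w)
    (henv : ∀ k, ∀ g ∈ W, ∀ w, ∀ q ∈ P.Base k g w, ∀ X : C.Dom, C.scale X = k →
      DifferentiableOn ℂ (fun z : Op × Hist F => P.Out k z.1 z.2 X) (closedBall q.1 (P.rOp k) ×ˢ closedBall q.2 (P.rHist k)) ∧
        ∀ z ∈ closedBall q.1 (P.rOp k) ×ˢ closedBall q.2 (P.rHist k), ‖P.Out k z.1 z.2 X‖ ≤ G * Real.exp (-(κ * C.d X)))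
    (hdA : ∀ g ∈ W, ∀ (u : 𝒰) (X : C.Dom), ‖ℰA g u X‖ ≤ G * Real.exp (-(κ * C.d X)))
    (hdB : ∀ g ∈ W, ∀ (u : 𝒰) (X : C.Dom), ‖ℰB g u X‖ ≤ E₀ * Real.exp (-(κ * C.d X))) (hE₀ : E₀ ≤ G)
    (hop : ∀ k, ∀ g ∈ W, ∀ w : 𝒰 × Fin 2, ‖P.opA g k w - P.opB g k w‖ ≤ δ * θ ^ k * P.rOp k)
    (hinsRate : ∀ k, ∀ g ∈ W, ∀ (t : C.Dom × (𝒰 × Fin 2) → ℝ), (∀ Y w, |t (Y, w)| ≤ E₀ * Real.exp (-(κ * C.d Y))) →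
      ∀ w, ‖P.insA g k t w - P.insB g k t w‖ ≤ δ' * θ ^ k * P.rHist k)
    (hins : ∀ k, ∀ g ∈ W, ∀ (t : C.Dom × (𝒰 × Fin 2) → ℝ) (w : 𝒰 × Fin 2), P.insA g k t w = insAtOfChannelC T out g k t w)
    (hadd : ChannelAdditive (Set.univ : Set (𝒰 × Fin 2 → C.Dom → ℝ)) T)
    (hsum : ChannelStepSum (Set.univ : Set (𝒰 × Fin 2 → C.Dom → ℝ)) T)
    (hsize : ChannelSizeAtStepNN (Set.univ : Set (𝒰 × Fin 2 → C.Dom → ℝ)) T κ wt τ) (hwt0 : ∀ k w i, 0 ≤ wt k (out w i))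
    (hwt : ∀ k w i, wt k (out w i) ≤ P.rHist (k + 1) * F.wt i) (hτ : ∀ k j, j ≤ k → τ k j ≤ c * ω ^ (k - j))
    (hG : 0 ≤ G) (hδ : 0 ≤ δ + δ') (hc : 0 ≤ c) (hω : 0 < ω) (hsmall : (1 + 4 * G * (Real.sqrt 2 * c / ω)) * ω < θ)
    (ι' : C.BgB → 𝒰) (hιA : ∀ g ∈ W, ∀ (U : C.BgB) (X : C.Dom), EA g (C.transport U) X = (ℰA g (ι' U) X).re)
    (hιB : ∀ g ∈ W, ∀ (U : C.BgB) (X : C.Dom), EB g U X = (ℰB g (ι' U) X).re) :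
    NE5 EA EB W κ θ (4 * G * (δ + δ') * (θ - ω) / (θ - (1 + 4 * G * (Real.sqrt 2 * c / ω)) * ω)) :=
  ne5_of_pointwiseSlots_reIm P hbdA hbdB hrA hrB hbase henv hdA hdB hE₀ hop hinsRate
    (insertionDamped_pointwise_of_insAtC P hins hadd hsum hsize hwt0 hwt hτ hc hω) hG hδ
    (div_nonneg (mul_nonneg (Real.sqrt_nonneg _) hc) hω.le) hω.le hsmall ι' hιA hιB

end End

end Summit.QuantumFields.BalabanUV.T4Continuum.InsertionChannelFamily

end
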